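import Summits.NavierStokesRegularity.NavierStokesRegularity.Theorems.SoloSalvageWu2026ConstructPieceEScaling
import Literature.Analysis.FluidPDE.DivCurlLpEstimate
import Mathlib.Analysis.FunctionalSpaces.SobolevInequality
import HarnessLib

/-!
# C177 `Wu2026` — toward `Step_construct` (E), Sobolev bounds (3.35): uniform `W^{1,9/5}` and
# `L^{9/2}` bounds of the localised blow-downs `χ_N V_j` at good scales ((3.34) + Sobolev)

Seat `ns-in-wu-341` on sub-binder (E) of `step_construct_of_pieces` (cut owner `ns-inputs-plan` g5,
08:24Z). Salvage conventions: theorems only, standard axioms, no definition, no named fact;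
`--supports` item 0897.

Print (arXiv:2608.22471v1, p.13 l.26–40): «Repeating the cutoff argument for (3.24), now with the
strong L^{9/5} Calderón–Zygmund estimate [16], gives ‖∇V_j‖_{L^{9/5}(G)} ≤ C_{G,G′}(‖curl V_j‖_{L^{9/5}(G′)}
+ ‖V_j‖_{L^{9/5}(G′)}) ≤ C_{G,G′}. (3.34) … The Sobolev embedding W^{1,9/5}(G) ↪ L^{9/2}(G)».
The Calderón–Zygmund input is the TREE's div–curl estimate
`Literature.Analysis.FluidPDE.exists_eLpNorm_fderiv_le_curl_add_divergence` (for test fields;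
applied to `χV_j` with `div(χV_j) = ⟨V_j, ∇χ⟩`, `curl(χV_j) = χ curl V_j + ∇χ × V_j`), and the
Sobolev embedding is Mathlib's Gagliardo–Nirenberg–Sobolev inequality
`MeasureTheory.eLpNorm_le_eLpNorm_fderiv_of_eq` (`p = 9/5`, `p* = 9/2`, `n = 3`).

* `exists_shellCutoff` — for every `N`, a cut-off `χ_N ∈ C_c^∞`, `0 ≤ χ_N ≤ 1`, `= 1` on
  `{1 + 1/(N+3) ≤ |y| ≤ 2^{N+1} − 1/3}`, `tsupport χ_N ⊆ {1 < |y| < 2^{N+1}}`, `‖Dχ_N‖ ≤ L_N`;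
* `eLpNorm_divergence_cutoff_smul_le`, `eLpNorm_curl_cutoff_smul_le` — the two Leibniz bounds;
* `pieceE_uniform_bounds` — **the interface for the weak-limit step**: for every `N` there are
  `χ_N` as above and `M_N < ∞` with `‖D(χ_N V_j)‖_{L^{9/5}} ≤ M_N` and `‖χ_N V_j‖_{L^{9/2}} ≤ M_N`
  for all good scales `j ≥ max{1, N}`.

WHAT THIS IS NOT: not a proof of `Step_construct`; not a claim about NS regularity or blow-up; not
a claim about any author beyond the typed locator.
-/

noncomputable section

set_option linter.dupNamespace false

open MeasureTheory Set Function Filter Topology Metric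
open scoped ENNReal NNReal RealInnerProductSpace ContDiff

namespace Summit.NavierStokesRegularity.NavierStokesRegularity.Theorems.Wu2026Salvage

open Literature.Claims.NS.Wu2026 Literature.Analysis.FluidPDE Literature.Analysis.FunctionSpaces

/-! ### Radial shell cut-offs -/

/-- A smooth radial «rise»: `ρ_{a,b} : ℝ³ → [0,1]`, `= 0` on `|z| ≤ a`, `= 1` on `|z| ≥ b`
(`0 < a < b`; `Real.smoothTransition` of `(|z|² − a²)/(b² − a²)`). [folklore] -/
theorem exists_radialRise {a b : ℝ} (ha : 0 < a) (hab : a < b) :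
    ∃ ρ : E3 → ℝ, ContDiff ℝ ∞ ρ ∧ (∀ z, ‖z‖ ≤ a → ρ z = 0) ∧ (∀ z, b ≤ ‖z‖ → ρ z = 1) ∧
      (∀ z, 0 ≤ ρ z ∧ ρ z ≤ 1) := by
  have hb : 0 < b := ha.trans hab
  have hd : 0 < b ^ 2 - a ^ 2 := by nlinarith
  refine ⟨fun z => Real.smoothTransition ((‖z‖ ^ 2 - a ^ 2) / (b ^ 2 - a ^ 2)), ?_,
    fun z hz => ?_, fun z hz => ?_,
    fun z => ⟨Real.smoothTransition.nonneg _, Real.smoothTransition.le_one _⟩⟩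
  · exact Real.smoothTransition.contDiff.comp
      (((contDiff_norm_sq ℝ).sub contDiff_const).div_const _)
  · refine Real.smoothTransition.zero_of_nonpos (div_nonpos_of_nonpos_of_nonneg ?_ hd.le)
    nlinarith [norm_nonneg z]
  · refine Real.smoothTransition.one_of_one_le ((one_le_div hd).2 ?_)
    nlinarith [norm_nonneg z]

/-- **Shell cut-offs**: for every `N` a `χ ∈ C_c^∞(ℝ³)` with `0 ≤ χ ≤ 1`, `χ = 1` on
`{1 + 1/(N+3) ≤ |y| ≤ 2^{N+1} − 1/3}`, `tsupport χ ⊆ {1 < |y| < 2^{N+1}}` and `‖Dχ‖ ≤ L`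
(product of a rise and a fall). [folklore] -/
theorem exists_shellCutoff (N : ℕ) :
    ∃ χ : E3 → ℝ, ContDiff ℝ ∞ χ ∧ HasCompactSupport χ ∧ (∀ y, 0 ≤ χ y ∧ χ y ≤ 1) ∧
      (∀ y, 1 + 1 / ((N : ℝ) + 3) ≤ ‖y‖ → ‖y‖ ≤ (2 : ℝ) ^ (N + 1) - 1 / 3 → χ y = 1) ∧
      tsupport χ ⊆ {y : E3 | 1 < ‖y‖ ∧ ‖y‖ < (2 : ℝ) ^ (N + 1)} ∧
      ∃ L : ℝ, 0 ≤ L ∧ ∀ y, ‖fderiv ℝ χ y‖ ≤ L := by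
  have hN3 : (0 : ℝ) < (N : ℝ) + 3 := by positivity
  have h2N : (2 : ℝ) ≤ (2 : ℝ) ^ (N + 1) := by
    calc (2 : ℝ) = 2 ^ 1 := (pow_one 2).symm
      _ ≤ 2 ^ (N + 1) := pow_le_pow_right₀ one_le_two (by omega)
  set a' : ℝ := 1 + 1 / (2 * ((N : ℝ) + 3)) with ha'
  set a : ℝ := 1 + 1 / ((N : ℝ) + 3) with ha
  set b : ℝ := (2 : ℝ) ^ (N + 1) - 1 / 3 with hb
  set b' : ℝ := (2 : ℝ) ^ (N + 1) - 1 / 6 with hb'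
  have ha'1 : 1 < a' := by
    have : 0 < 1 / (2 * ((N : ℝ) + 3)) := by positivity
    rw [ha']; linarith
  have ha'a : a' < a := by
    rw [ha', ha]
    have := one_div_lt_one_div_of_lt hN3 (by linarith : (N : ℝ) + 3 < 2 * ((N : ℝ) + 3))
    linarith
  have hbb' : b < b' := by rw [hb, hb']; linarith
  have hb'2 : b' < (2 : ℝ) ^ (N + 1) := by rw [hb']; linarith
  have hb0 : 0 < b := by rw [hb]; linarith
  obtain ⟨ρ₁, hρ₁s, hρ₁0, hρ₁1, hρ₁01⟩ := exists_radialRise (by linarith : 0 < a') ha'a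
  obtain ⟨ρ₂, hρ₂s, hρ₂0, hρ₂1, hρ₂01⟩ := exists_radialRise hb0 hbb'
  set χ : E3 → ℝ := fun y => ρ₁ y * (1 - ρ₂ y) with hχ
  have hχs : ContDiff ℝ ∞ χ := hρ₁s.mul (contDiff_const.sub hρ₂s)
  have hzero : ∀ y, (‖y‖ ≤ a' ∨ b' ≤ ‖y‖) → χ y = 0 := fun y hy => by
    rcases hy with hy | hy
    · rw [hχ]; simp [hρ₁0 y hy]
    · rw [hχ]; simp [hρ₂1 y hy]
  have hsupp : support χ ⊆ {y : E3 | a' < ‖y‖ ∧ ‖y‖ < b'} := fun y hy => by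
    by_contra hcon
    simp only [mem_setOf_eq, not_and_or, not_lt] at hcon
    exact hy (hzero y hcon)
  have hclosed : IsClosed ({y : E3 | a' ≤ ‖y‖} ∩ {y : E3 | ‖y‖ ≤ b'}) :=
    (isClosed_le continuous_const continuous_norm).inter (isClosed_le continuous_norm continuous_const)
  have htsupp : tsupport χ ⊆ {y : E3 | a' ≤ ‖y‖} ∩ {y : E3 | ‖y‖ ≤ b'} :=
    closure_minimal (fun y hy => ⟨(hsupp hy).1.le, (hsupp hy).2.le⟩) hclosed
  have hχc : HasCompactSupport χ := by
    refine HasCompactSupport.of_support_subset_isCompact (isCompact_closedBall (0 : E3) b') ?_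
    intro y hy
    rw [mem_closedBall, dist_zero_right]
    exact (hsupp hy).2.le
  obtain ⟨L, hL⟩ := (hχs.continuous_fderiv (by simp)).bounded_above_of_compact_support
    (hχc.fderiv (𝕜 := ℝ))
  refine ⟨χ, hχs, hχc, fun y => ?_, fun y h1 h2 => ?_, ?_, max L 0, le_max_right _ _,
    fun y => (hL y).trans (le_max_left _ _)⟩
  · rw [hχ]
    exact ⟨mul_nonneg (hρ₁01 y).1 (by linarith [(hρ₂01 y).2]),
      mul_le_one₀ (hρ₁01 y).2 (by linarith [(hρ₂01 y).2]) (by linarith [(hρ₂01 y).1])⟩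
  · rw [hχ]
    show ρ₁ y * (1 - ρ₂ y) = 1
    rw [hρ₁1 y h1, hρ₂0 y h2]; ring
  · exact htsupp.trans fun y hy => ⟨ha'1.trans_le hy.1, hy.2.trans_lt hb'2⟩

/-! ### Leibniz bounds for `div(χV)` and `curl(χV)` -/

/-- `‖S.indicator f‖ₑ` dominates a function vanishing off `S` and bounded by `f` on `S`. -/
private theorem enorm_le_indicator {F G : Type*} [NormedAddCommGroup F] [NormedAddCommGroup G]
    {g : E3 → F} {f : E3 → G} {S : Set E3} {c : ℝ≥0} (hS : ∀ y ∉ S, g y = 0)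
    (hle : ∀ y ∈ S, ‖g y‖₊ ≤ c * ‖f y‖₊) (y : E3) : ‖g y‖₊ ≤ c * ‖S.indicator f y‖₊ := by
  by_cases hy : y ∈ S
  · rw [indicator_of_mem hy]; exact hle y hy
  · rw [hS y hy]; simp

/-- **`‖div(χV)‖_{L^p} ≤ L ‖V‖_{L^p(tsupport χ)}`** for a divergence-free `C¹` field `V` and a `C¹`
cut-off with `‖Dχ‖ ≤ L` (`div(χV) = ⟨V, ∇χ⟩`). [cite: Wu2026, (3.34) p.13 l.26–30] -/
theorem eLpNorm_divergence_cutoff_smul_le {V : E3 → E3} (hV : ContDiff ℝ 1 V)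
    (hdiv : VectorCalculus.IsDivFree V) {χ : E3 → ℝ} (hχ : ContDiff ℝ 1 χ) {L : ℝ≥0}
    (hL : ∀ y, ‖fderiv ℝ χ y‖ ≤ L) (p : ℝ≥0∞) :
    eLpNorm (VectorCalculus.divergence fun y => χ y • V y) p volume ≤
      L • eLpNorm ((tsupport χ).indicator V) p volume := by
  refine eLpNorm_le_nnreal_smul_eLpNorm_of_ae_le_mul (Eventually.of_forall fun y => ?_) p
  refine enorm_le_indicator (fun y hy => ?_) (fun y _ => ?_) y
  · -- off `tsupport χ` the field `χV` vanishes near `y`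
    have hev : (fun z => χ z • V z) =ᶠ[𝓝 y] fun _ => 0 := by
      filter_upwards [(isClosed_tsupport χ).isOpen_compl.mem_nhds hy] with z hz
      rw [image_eq_zero_of_notMem_tsupport hz, zero_smul]
    rw [VectorCalculus.divergence, hev.fderiv_eq]
    simp
  · have hd := Literature.Analysis.FluidPDE.divergence_smul_apply
      (hχ.differentiable one_ne_zero y) (hV.differentiable one_ne_zero y)
    rw [hdiv y, mul_zero, zero_add] at hd
    rw [hd]
    have h1 : |⟪V y, gradient χ y⟫| ≤ ‖V y‖ * ‖gradient χ y‖ := abs_real_inner_le_norm _ _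
    have h2 : ‖gradient χ y‖ = ‖fderiv ℝ χ y‖ := by
      rw [gradient, LinearIsometryEquiv.norm_map]
    rw [← NNReal.coe_le_coe]
    push_cast
    rw [Real.norm_eq_abs]
    calc |⟪V y, gradient χ y⟫| ≤ ‖V y‖ * ‖fderiv ℝ χ y‖ := by rw [← h2]; exact h1
      _ ≤ ‖V y‖ * L := mul_le_mul_of_nonneg_left (hL y) (norm_nonneg _)
      _ = L * ‖V y‖ := mul_comm _ _

/-- **`‖curl(χV)‖_{L^p} ≤ ‖curl V‖_{L^p(tsupport χ)} + κL ‖V‖_{L^p(tsupport χ)}`**, `κ = ‖curlCLM‖`,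
for a `C¹` field and a `C¹` cut-off with `0 ≤ χ ≤ 1`, `‖Dχ‖ ≤ L`
(`curl(χV) = χ curl V + curlCLM(Dχ ⊗ V)`). [cite: Wu2026, (3.34) p.13 l.26–30] -/
theorem eLpNorm_curl_cutoff_smul_le {V : E3 → E3} (hV : ContDiff ℝ 1 V) {χ : E3 → ℝ}
    (hχ : ContDiff ℝ 1 χ) (hχ01 : ∀ y, 0 ≤ χ y ∧ χ y ≤ 1) {L : ℝ≥0} (hL : ∀ y, ‖fderiv ℝ χ y‖ ≤ L)
    {p : ℝ≥0∞} (hp : 1 ≤ p) :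
    eLpNorm (curl fun y => χ y • V y) p volume ≤
      eLpNorm ((tsupport χ).indicator (curl V)) p volume +
        (‖curlCLM‖₊ * L) • eLpNorm ((tsupport χ).indicator V) p volume := by
  have hsplit : (curl fun y => χ y • V y) = (fun y => χ y • curl V y) +
      fun y => curlCLM ((fderiv ℝ χ y).smulRight (V y)) := by
    funext y
    exact curl_smul (hχ.differentiable one_ne_zero y) (hV.differentiable one_ne_zero y)
  rw [hsplit]
  have hm1 : AEStronglyMeasurable (fun y => χ y • curl V y) volume :=
    (hχ.continuous.smul (continuous_curl hV)).aestronglyMeasurable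
  have hm2 : AEStronglyMeasurable (fun y => curlCLM ((fderiv ℝ χ y).smulRight (V y))) volume := by
    have heq : (fun y => curlCLM ((fderiv ℝ χ y).smulRight (V y))) =
        fun y => curl (fun y => χ y • V y) y - χ y • curl V y := by
      funext y
      rw [curl_smul (hχ.differentiable one_ne_zero y) (hV.differentiable one_ne_zero y)]
      abel
    rw [heq]
    exact (continuous_curl (hχ.smul hV)).aestronglyMeasurable.sub hm1
  refine (eLpNorm_add_le hm1 hm2 hp).trans (add_le_add ?_ ?_)
  · have hpt : ∀ y, ‖χ y • curl V y‖₊ ≤ 1 * ‖(tsupport χ).indicator (curl V) y‖₊ := by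
      intro y
      refine enorm_le_indicator (g := fun y => χ y • curl V y) (f := curl V) (S := tsupport χ)
        (c := 1) (fun y hy => ?_) (fun y _ => ?_) y
      · show χ y • curl V y = 0
        rw [image_eq_zero_of_notMem_tsupport hy, zero_smul]
      · rw [one_mul, nnnorm_smul]
        calc ‖χ y‖₊ * ‖curl V y‖₊ ≤ 1 * ‖curl V y‖₊ := by
              refine mul_le_mul' ?_ le_rfl
              rw [← NNReal.coe_le_coe, coe_nnnorm, Real.norm_eq_abs, abs_of_nonneg (hχ01 y).1]
              exact_mod_cast (hχ01 y).2
          _ = ‖curl V y‖₊ := one_mul _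
    have h := eLpNorm_le_nnreal_smul_eLpNorm_of_ae_le_mul (μ := (volume : Measure E3))
      (Eventually.of_forall hpt) p
    rwa [one_smul] at h
  · have hpt : ∀ y, ‖curlCLM ((fderiv ℝ χ y).smulRight (V y))‖₊ ≤
        (‖curlCLM‖₊ * L) * ‖(tsupport χ).indicator V y‖₊ := by
      intro y
      refine enorm_le_indicator (g := fun y => curlCLM ((fderiv ℝ χ y).smulRight (V y)))
        (f := V) (S := tsupport χ) (c := ‖curlCLM‖₊ * L) (fun y hy => ?_) (fun y _ => ?_) y
      · show curlCLM ((fderiv ℝ χ y).smulRight (V y)) = 0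
        rw [fderiv_of_notMem_tsupport ℝ hy]
        simp
      · calc ‖curlCLM ((fderiv ℝ χ y).smulRight (V y))‖₊
            ≤ ‖curlCLM‖₊ * ‖(fderiv ℝ χ y).smulRight (V y)‖₊ := curlCLM.le_opNNNorm _
          _ = ‖curlCLM‖₊ * (‖fderiv ℝ χ y‖₊ * ‖V y‖₊) := by
              rw [ContinuousLinearMap.nnnorm_smulRight_apply]
          _ ≤ ‖curlCLM‖₊ * (L * ‖V y‖₊) := by
              refine mul_le_mul' le_rfl (mul_le_mul' ?_ le_rfl)
              rw [← NNReal.coe_le_coe, coe_nnnorm]; exact hL y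
          _ = ‖curlCLM‖₊ * L * ‖V y‖₊ := by ring
    exact eLpNorm_le_nnreal_smul_eLpNorm_of_ae_le_mul (μ := (volume : Measure E3))
      (Eventually.of_forall hpt) p

end Summit.NavierStokesRegularity.NavierStokesRegularity.Theorems.Wu2026Salvage

end
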